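import Summits.MatrixMultiplication.OmegaCensus.SmallFormats.MatMul22nRankGF7PackW
import Literature.NumberTheory.NumberFields.NFIsoNormPoly
import HarnessLib

/-!
# ω-census family (a): 'plane' (SIMD) arithmetic on many 42-digit lanes at once — the operations of the slack-5 bucket check and their meaning

Cell `pub-omega` (unit `pub-omega-tensor-g16`), topic `Summits/MatrixMultiplication/OmegaCensus` (sub-folder `SmallFormats`).
Framing (verbatim): lottery ticket; floor = certified bounds/negative ranges. HONEST FRAMING: kernel infrastructure
(`pub-omega-tensor-g16/KERNEL-S5-DESIGN.md` §3): big-number operations that the Lean kernel evaluates with GMP act on all lanes of a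
packed family of 42-vectors simultaneously; this file defines them and proves what they compute lane by lane. Nothing here is progress on `ω`.

A PLANE with `n` lanes is `packW 588 f n` with lane values `f c < 2^588`; a lane holds 42 digits of 14 bits (`588 = 42·14`).
* `laneMask5 n` = the digit-0 mask of `n` lanes; `plane_shift_mask`: `(X >>> t) &&& laneMask5 n` reads bits `t … t+13` of every lane;
* `plane_place`: `Σ_z Y_z <<< 14z` assembles lanes digit by digit;
* `plane_dot`: one multiplication by a reversed 42-digit coefficient vector puts the 42-term dot product of EVERY lane at its digit 41;
* `resid5` / `plane_resid`: lane-wise residues mod 7 by multiply-high (`⌊v/7⌋ = (v·18725) >>> 17` for `v < 2^14`);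
* `plane_lincomb`: `Σ_i R_i·7^i` combines residue planes into key planes; `plane_peel_*`: reading lane 0 and dropping it;
* `dot_digitW`: whole-vector dot product as one digit of a product (CHECK B needs); `packW_fld_self`: a number is the packing of its digits.
-/

namespace Summit.MatrixMultiplication.OmegaCensus.SmallFormats

open Finset
open Literature.NumberTheory.NumberFields (list_sum_range_map)

-- `2^588` appears in types only symbolically; allow the unifier to fold it without the threshold warning.
set_option exponentiation.threshold 1024

/-! ## The mask -/

/-- Digit-0 mask of `n` lanes: `Σ_{c<n} (2^14 − 1)·2^(588 c)` (kernel-evaluable form). -/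
def laneMask5 (n : ℕ) : ℕ := ((List.range n).map fun c => (2 ^ 14 - 1) * 2 ^ (588 * c)).sum

/-- The mask is the plane with every lane equal to `2^14 − 1`. -/
theorem laneMask5_eq (n : ℕ) : laneMask5 n = packW 588 (fun _ => 2 ^ 14 - 1) n := by
  unfold laneMask5 packW; rw [list_sum_range_map]

/-- `2^14 ≤ 2^588` (kept symbolic: large powers are never evaluated). -/
theorem two_pow_14_le_588 : (2 : ℕ) ^ 14 ≤ 2 ^ 588 := Nat.pow_le_pow_right (by norm_num) (by norm_num)

/-- Bits of the mask: bit `i` is set iff it is one of the low 14 bits of a lane `< n`. -/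
theorem testBit_laneMask5 (n i : ℕ) : (laneMask5 n).testBit i = (decide (i / 588 < n) && decide (i % 588 < 14)) := by
  rw [laneMask5_eq, testBit_packW (by norm_num) _ (fun _ _ => lt_of_lt_of_le (by norm_num) two_pow_14_le_588),
    Nat.testBit_two_pow_sub_one]

/-! ## Shifting and masking -/

/-- **Reading a bit-field of every lane.** For a plane `X = packW 588 f N` (`f c < 2^588`), `n ≤ N` and `t + 14 ≤ 588`:
`(X >>> t) &&& laneMask5 n` is the plane whose lane `c < n` is `(f c >>> t) % 2^14`. -/
theorem plane_shift_mask {f : ℕ → ℕ} {N n t : ℕ} (hf : ∀ c < N, f c < 2 ^ 588) (hn : n ≤ N) (ht : t + 14 ≤ 588) :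
    (packW 588 f N >>> t) &&& laneMask5 n = packW 588 (fun c => (f c >>> t) % 2 ^ 14) n := by
  apply Nat.eq_of_testBit_eq
  intro i
  have hg : ∀ c < n, (fun c => (f c >>> t) % 2 ^ 14) c < 2 ^ 588 :=
    fun c _ => lt_of_lt_of_le (Nat.mod_lt _ (by norm_num)) two_pow_14_le_588
  rw [Nat.testBit_and, Nat.testBit_shiftRight, testBit_laneMask5, testBit_packW (by norm_num) f hf,
    testBit_packW (by norm_num) _ hg]
  simp only [Nat.testBit_mod_two_pow, Nat.testBit_shiftRight]
  by_cases ho : i % 588 < 14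
  · have e1 : (t + i) / 588 = i / 588 := by omega
    have e2 : (t + i) % 588 = t + i % 588 := by omega
    rw [e1, e2]
    by_cases hc : i / 588 < n
    · simp [ho, hc, show i / 588 < N by omega]
    · simp [hc]
  · simp [ho]

/-- **Placing digits.** Assembling a plane digit position by digit position: `Σ_{z<42} (packW 588 (g z) n)·2^(14 z)` is the plane whose
lane `c` is `packW 14 (z ↦ g z c) 42`. -/
theorem plane_place (g : ℕ → ℕ → ℕ) (n : ℕ) :
    ((List.range 42).map fun z => packW 588 (g z) n * 2 ^ (14 * z)).sum = packW 588 (fun c => packW 14 (fun z => g z c) 42) n := by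
  rw [list_sum_range_map]
  unfold packW
  simp only [sum_mul]
  rw [sum_comm]
  refine sum_congr rfl fun c _ => sum_congr rfl fun z _ => by ring

/-! ## Lane dot products -/

/-- **All dot products at once.** For a plane of 42-vectors `p c` (`p c z ≤ 5`) and a coefficient vector `l` (`l z ≤ 6`) packed in
reverse as `G = packW 14 (j ↦ l (41 − j)) 42`: `((X * G) >>> 574) &&& laneMask5 n` is the plane whose lane `c < n` is `Σ_z p c z · l z`. -/
theorem plane_dot {p : ℕ → ℕ → ℕ} {n : ℕ} (hp : ∀ c < n, ∀ z < 42, p c z ≤ 5) {l : ℕ → ℕ} (hl : ∀ z < 42, l z ≤ 6) :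
    ((packW 588 (fun c => packW 14 (p c) 42) n * packW 14 (fun j => l (41 - j)) 42) >>> 574) &&& laneMask5 n
      = packW 588 (fun c => ∑ z ∈ range 42, p c z * l z) n := by
  -- flatten the plane to digits
  have hp' : ∀ i < 42 * n, (fun i => p (i / 42) (i % 42)) i ≤ 5 :=
    fun i hi => hp _ (by omega) _ (Nat.mod_lt _ (by norm_num))
  have hflat : packW 588 (fun c => packW 14 (p c) 42) n = packW 14 (fun i => p (i / 42) (i % 42)) (42 * n) := packW_nest 14 42 p n
  -- the product is the packing of the convolution, a digit expansion of length 42 (n + 1)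
  set conv := convW (fun i => p (i / 42) (i % 42)) (fun j => l (41 - j)) (42 * n) 42 with hconv
  have hcb : ∀ k, conv k < 2 ^ 14 := fun k =>
    lt_of_le_of_lt (convW_le _ _ (42 * n) 42 k 5 6 hp' (fun j hj => hl _ (by omega))) (by norm_num)
  have hprod : packW 14 (fun i => p (i / 42) (i % 42)) (42 * n) * packW 14 (fun j => l (41 - j)) 42
      = packW 588 (fun c => packW 14 (fun z => conv (42 * c + z)) 42) (n + 1) := by
    have e2 : packW 588 (fun c => packW 14 (fun z => conv (42 * c + z)) 42) (n + 1)
        = packW 14 (fun i => conv (42 * (i / 42) + i % 42)) (42 * (n + 1)) := packW_nest 14 42 (fun c z => conv (42 * c + z)) (n + 1)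
    rw [packW_mul, e2, show 42 * n + 42 = 42 * (n + 1) by ring]
    unfold packW
    exact sum_congr rfl fun i _ => by
      show _ = conv (42 * (i / 42) + i % 42) * _
      rw [Nat.div_add_mod]
  have hlane : ∀ c < n + 1, (fun c => packW 14 (fun z => conv (42 * c + z)) 42) c < 2 ^ 588 :=
    fun c _ => packW_lt (W := 14) (fun z => conv (42 * c + z)) 42 (fun z _ => hcb _)
  rw [hflat, hprod, plane_shift_mask hlane (by omega) (by norm_num)]
  refine packW_congr 588 fun c hc => ?_
  show packW 14 (fun z => conv (42 * c + z)) 42 >>> 574 % 2 ^ 14 = ∑ z ∈ range 42, p c z * l z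
  have e : packW 14 (fun z => conv (42 * c + z)) 42 >>> 574 % 2 ^ 14 = fld 14 (packW 14 (fun z => conv (42 * c + z)) 42) 41 := by
    rw [fldW_eq, Nat.shiftRight_eq_div_pow]
  rw [e, fld_packW _ (fun z _ => hcb _), if_pos (by norm_num), hconv, convW_lane _ l hc]
  exact sum_congr rfl fun z hz => by
    have hz' := mem_range.1 hz
    show p ((42 * c + z) / 42) ((42 * c + z) % 42) * l z = p c z * l z
    rw [show (42 * c + z) / 42 = c by omega, show (42 * c + z) % 42 = z by omega]

/-! ## Residues mod 7 -/

/-- Lane-wise residue mod 7 of a plane whose lanes hold values `< 2^14` (multiply-high division by 7). -/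
def resid5 (n X : ℕ) : ℕ := X - 7 * (((X * 18725) >>> 17) &&& laneMask5 n)

/-- The multiply-high quotient is exact below `2^14` (`7 · 18725 = 2^17 + 3`). -/
theorem mulHigh7_ok {v : ℕ} (hv : v < 2 ^ 14) : (v * 18725) >>> 17 = v / 7 := by
  rw [Nat.shiftRight_eq_div_pow]
  have h : (2 : ℕ) ^ 17 = 131072 := by norm_num
  have h14 : (2 : ℕ) ^ 14 = 16384 := by norm_num
  rw [h]; rw [h14] at hv; omega

/-- **Lane-wise residues.** For lane values `v c < 2^14`: `resid5 n (packW 588 v n)` is the plane of `v c % 7`. -/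
theorem plane_resid {v : ℕ → ℕ} {n : ℕ} (hv : ∀ c < n, v c < 2 ^ 14) :
    resid5 n (packW 588 v n) = packW 588 (fun c => v c % 7) n := by
  unfold resid5
  have hmul : packW 588 v n * 18725 = packW 588 (fun c => 18725 * v c) n := by rw [packW_smul]; ring
  have hb : ∀ c < n, (fun c => 18725 * v c) c < 2 ^ 588 := fun c hc => by
    show 18725 * v c < 2 ^ 588
    exact lt_of_lt_of_le (by have := hv c hc; omega : 18725 * v c < 2 ^ 29) (Nat.pow_le_pow_right (by norm_num) (by norm_num))
  rw [hmul, plane_shift_mask hb le_rfl (by norm_num)]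
  have hq : ∀ c < n, (fun c => (18725 * v c) >>> 17 % 2 ^ 14) c = v c / 7 := by
    intro c hc
    show (18725 * v c) >>> 17 % 2 ^ 14 = v c / 7
    rw [mul_comm, mulHigh7_ok (hv c hc), Nat.mod_eq_of_lt (by have := hv c hc; omega)]
  rw [packW_congr 588 hq, ← packW_smul, packW_sub 588 (fun c _ => Nat.mul_div_le (v c) 7)]
  exact packW_congr 588 fun c _ => by show v c - 7 * (v c / 7) = v c % 7; omega

/-! ## Linear combinations and peeling -/

/-- Combining planes with scalar weights: `Σ_{i<m} R_i · w i` where `R_i = packW 588 (r i) n` is the plane of `Σ_i r i c · w i`. -/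
theorem plane_lincomb (r : ℕ → ℕ → ℕ) (w : ℕ → ℕ) (m n : ℕ) :
    ((List.range m).map fun i => packW 588 (r i) n * w i).sum = packW 588 (fun c => ∑ i ∈ range m, r i c * w i) n := by
  rw [list_sum_range_map, packW_sum]
  refine sum_congr rfl fun i _ => ?_
  rw [show (fun c => r i c * w i) = fun c => w i * r i c from funext fun c => mul_comm _ _, packW_smul]; ring

/-- Dropping lane 0: `packW 588 f (n+1) >>> 588` is the plane of the shifted lanes. -/
theorem plane_peel_shift (f : ℕ → ℕ) (n : ℕ) (hf : ∀ c < n + 1, f c < 2 ^ 588) :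
    packW 588 f (n + 1) >>> 588 = packW 588 (fun c => f (c + 1)) n := by
  apply Nat.eq_of_testBit_eq
  intro i
  rw [Nat.testBit_shiftRight, testBit_packW (by norm_num) f hf, testBit_packW (by norm_num) _ (fun c hc => hf (c + 1) (by omega))]
  rw [show (588 + i) / 588 = i / 588 + 1 by omega, show (588 + i) % 588 = i % 588 by omega]
  by_cases h : i / 588 < n
  · simp [h, show i / 588 + 1 < n + 1 by omega]
  · simp [h, show ¬ (i / 588 + 1 < n + 1) by omega]

/-- Reading lane 0 when it holds a value `< 2^34`: `X &&& (2^34 − 1)`. -/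
theorem plane_peel_read (f : ℕ → ℕ) (n : ℕ) (hf : ∀ c < n + 1, f c < 2 ^ 588) (h0 : f 0 < 2 ^ 34) :
    packW 588 f (n + 1) &&& (2 ^ 34 - 1) = f 0 := by
  rw [Nat.and_two_pow_sub_one_eq_mod]
  have h := packW_digit (W := 588) f hf (j := 0) (by omega)
  simp only [mul_zero, pow_zero, Nat.div_one] at h
  rw [← Nat.mod_mod_of_dvd _ (pow_dvd_pow 2 (by norm_num : 34 ≤ 588)), h, Nat.mod_eq_of_lt h0]

/-! ## Whole-vector dot products and self-packing (used by the CHECK B semantics) -/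

/-- The convolution coefficient `N − 1` against the reversed vector is the full dot product. -/
theorem convW_rev (p l : ℕ → ℕ) {N : ℕ} (hN : 0 < N) :
    convW p (fun i => l (N - 1 - i)) N N (N - 1) = ∑ i ∈ range N, p i * l i := by
  unfold convW
  have e : (range N ×ˢ range N).filter (fun x : ℕ × ℕ => x.1 + x.2 = N - 1) = (range N).image fun i => (i, N - 1 - i) := by
    ext x
    rw [mem_filter, mem_product, mem_range, mem_range, mem_image]
    constructor
    · rintro ⟨⟨h1, _⟩, h3⟩
      refine ⟨x.1, mem_range.2 h1, ?_⟩
      ext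
      · rfl
      · show N - 1 - x.1 = x.2
        omega
    · rintro ⟨i, hi, rfl⟩
      have := mem_range.1 hi
      exact ⟨⟨this, by show N - 1 - i < N; omega⟩, by show i + (N - 1 - i) = N - 1; omega⟩
  rw [e, sum_image (fun i _ j _ h => by simpa using congrArg Prod.fst h)]
  refine sum_congr rfl fun i hi => ?_
  have := mem_range.1 hi
  show p i * l (N - 1 - (N - 1 - i)) = p i * l i
  rw [show N - 1 - (N - 1 - i) = i by omega]

/-- **Dot product as a digit** (whole vectors): for `p i ≤ A`, `l i ≤ B` (`i < N`), `0 < N`, `N·A·B < 2^W`, digit `N − 1` of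
`packW W p N * packW W (i ↦ l (N−1−i)) N` is `Σ_{i<N} p i · l i`. -/
theorem dot_digitW {W A B : ℕ} (p l : ℕ → ℕ) {N : ℕ} (hN : 0 < N) (hb : N * (A * B) < 2 ^ W) (hp : ∀ i < N, p i ≤ A)
    (hl : ∀ i < N, l i ≤ B) : fld W (packW W p N * packW W (fun i => l (N - 1 - i)) N) (N - 1) = ∑ i ∈ range N, p i * l i := by
  rw [packW_mul]
  have hl' : ∀ i < N, (fun i => l (N - 1 - i)) i ≤ B := fun i hi => hl _ (by omega)
  have hbound : ∀ k < N + N, convW p (fun i => l (N - 1 - i)) N N k < 2 ^ W :=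
    fun k _ => lt_of_le_of_lt (convW_le p _ N N k A B hp hl') hb
  have h := fld_packW (convW p (fun i => l (N - 1 - i)) N N) hbound (N - 1)
  unfold packW at h
  rw [h, if_pos (by omega), convW_rev p l hN]

/-- A number below `2^(W n)` is the packing of its own `n` digits. -/
theorem packW_fld_self {W : ℕ} (hW : 0 < W) {N n : ℕ} (hN : N < 2 ^ (W * n)) : packW W (fun j => fld W N j) n = N := by
  apply Nat.eq_of_testBit_eq
  intro i
  have hd : ∀ j < n, (fun j => fld W N j) j < 2 ^ W := fun j _ => by
    show fld W N j < 2 ^ W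
    rw [fldW_eq]; exact Nat.mod_lt _ (Nat.two_pow_pos _)
  rw [testBit_packW hW _ hd]
  by_cases h : i / W < n
  · have e : (fld W N (i / W)).testBit (i % W) = N.testBit i := by
      rw [fldW_eq, Nat.testBit_mod_two_pow, Nat.testBit_div_two_pow]
      have : i % W + W * (i / W) = i := Nat.mod_add_div i W
      simp [Nat.mod_lt _ hW, this]
    simp [h, e]
  · have hi : W * n ≤ i := by
      have h1 : n ≤ i / W := by omega
      have h2 : n * W ≤ i := (Nat.le_div_iff_mul_le hW).1 h1
      rw [Nat.mul_comm]; exact h2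
    have hlt : N < 2 ^ i := lt_of_lt_of_le hN (Nat.pow_le_pow_right (by norm_num) hi)
    simp [h, Nat.testBit_lt_two_pow hlt]

end Summit.MatrixMultiplication.OmegaCensus.SmallFormats
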